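import Summits.BirchSwinnertonDyer.Rank1Residual.GaloisImage.TorsionLevelTwoDevissage
import Summits.BirchSwinnertonDyer.Rank1Residual.GaloisImage.KolyvaginLevelOneNineDivides
import Summits.BirchSwinnertonDyer.Rank1Residual.GaloisImage.KatoKuriharaDictionaryThree
import Summits.BirchSwinnertonDyer.Rank1Residual.GaloisImage.PropagatedStructureUnramified
import Summits.BirchSwinnertonDyer.Rank1Residual.Additive.KimThreeKummerCartesian
import HarnessLib

/-!
# END-m2 — "nine divides Ш" on class A2 (`#E(ℚ₃)[3] = 3`): the LEVEL-TWO non-unit lower end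
# (cell `b2b-bsdres`, team n1011, seat p15 GEN 4, OWNERS row T-INJ-DEV file F-D; ROUTE-1 §33.3's A2
# analogue of R1-57 END-m1, datum-generic per route planner 1 GEN 23; skeleton
# `cells/n1011/skel/T-INJ-DEV.md`)

HONEST FRAMING (cell `b2b-bsdres`, run/shared/lean/b2b/bsd-rank1-residual/, verbatim in every
file): the goal of the cell is to DELETE the COMBINATION-SHAPED residual classes of the
Birch–Swinnerton-Dyer formula for ALL analytic-rank `≤ 1` elliptic curves over `ℚ` — "full BSD
formula for every rank `≤ 1` curve in class `C`" assembled STRICTLY from published theorems — so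
that the rank-`≤ 1` remainder becomes exactly the CONSTRUCTION-SHAPED classes, which are TYPED
(missing-input `Prop`s), NOT attempted. This is not "finishing BSD". Team n1011 (N10 / N11, the
additive block X4 ∧ `p = 3`): research route on the CONSTRUCTION-SHAPED class X4; prove what is
provable now; no claim beyond stated classes; nothing is booked; no label and no RESIDUAL-MAP mark
is moved. END-m2, like END-m1, is DEBT REDUCTION (the LOWER half of BSD₃ on class-A2 rows becomes
[S24]-free the day its injectivity input is discharged by n1011-p11's G5 / R1-58), NOT coverage; the
PORT (the dictionary `KatoKuriharaDictionaryThreeAt W 1 1 D v₃` at depth `1`, flag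
K22-Thm3.13-PORT@3) and the injectivity input are HYPOTHESES. Theorems only: no definition, no named
fact, no `sorry`.

## What
On an additive `3 ∤ c₃`, surj(3), `#E(ℚ₃)[3] = 3` (t = 1) row the level-ONE value clause of the
Kato–Kurihara dictionary is void (`3^t ≡ 0 (mod 3)`); one depth up it is not: DICT3 at depth `1`
gives Kato-type classes `κ` of `E[9]`, a Kolyvagin system `κ′ ∈ KS(E[9], 𝓕_can, D₉)` congruent to
them and `Λ(loc_{v₃} κ_d) = u · 3 · δ̃_d ∈ ℤ/9`.  ONE level `n` with `δ̃_n ≢ 0 (mod 3)` gives `κ_n ≠ 0`,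
so `κ′_c ≠ 0` for some `c ⊆ n` (n1011-p09's `exists_subset_apply_ne_zero_of_congruence`), while
`3 ∣ [0]⁺` puts `κ′_∅` in `Sel^(9)`.  Then `Sel^(3)(E/ℚ) ≠ 0`: if the residual dual Selmer group is
non-zero, by COUNTING (`#H¹_{𝓕̄_can} = 3 · #H¹_{𝓕̄_can^*} ≥ 6` against `Λ ∘ loc_{v₃} ∘ incl_*`, whose
values are `3`-torsion in `ℤ/9` and whose kernel lies in `Sel^(3)` — Λ-kernel clause + Kummer
CARTESIAN); if it is zero, `Sel^(3) = 0` would force `Sel^(9) = 0`, `κ′_∅ = 0`, and `κ′ ≡ 0` by the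
INJECTIVITY DÉVISSAGE `KSDevissage.apply_eq_zero_of_apply_eq_zero_levelTwo` (F-B2) from the `m = 1`
injectivity on the `E[3]`-datum with the same primes — contradiction.  §1: depth-`1` Kummer
bookkeeping; §2: **`exists_ne_zero_mem_selmerGroup_three_of_dictionaryTwo_of_levelTwo_certificate`**
(END-m2, DATUM-GENERIC — the record side pins the deep class through `E[27]`, port guard
`IsCanonicalTauDatumThreeAt W (1 + 1) 1`; conclusion in n1011-p18's R1-57-B currency).  Certificate =
ONE level of `D₉` with `3 · δ̃_n ≠ 0` in `ℤ/9` (independent of the surjective discrete logarithms):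
NO `ν(n)`, NO sub-level vanishing, NO parity.  Honest record price (r1 GEN 23 (3)): such a level is
`27`-admissible at every prime; no engine value exists today.

References: C.-H. Kim, AJM 148 (2026) Thm. 3.13 [Kim2022StructureSelmer]; B. Mazur, K. Rubin,
Mem. AMS 799 (2004) Thm. 3.2.4, §4.5, App. A (33); R. Sakamoto, JTNB 36 (2024) Def. 3.5, Thm. 4.4
[Sakamoto2024]; J. S. Milne, *ADT* I §6 [MilneADT2006].
-/

noncomputable section
open scoped Classical NumberField ContRepresentation
open Field NumberField IsDedekindDomain
open WeierstrassCurve Literature.NumberTheory.EllipticCurves Literature.NumberTheory.EllipticCurves.ModularForms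
  Literature.NumberTheory.EllipticCurves.Rank1Residual
  Literature.NumberTheory.GaloisRepresentations
  Literature.NumberTheory.GaloisRepresentations.DiscreteGaloisModule Literature.NumberTheory.GaloisCohomology
open Literature.NumberTheory.DiophantineGeometry.Dioph (ratModP)

namespace Summit.BirchSwinnertonDyer.Rank1Residual.GaloisImage
variable (W : WeierstrassCurve ℚ) [W.IsElliptic]
namespace KSDevissage

/-! ### §1 Depth-`1` Kummer bookkeeping on `E[9] = E[3¹·3]` -/
/-- **A class of `H¹_{𝓕_can}(ℚ, E[9])` whose localisation above `3` is a Kummer class lies in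
`Sel^(9)(E/ℚ)`**: off `3` the canonical structure IS the Kummer condition (n1011-p05's
`propagatedSelmerStructure_inr_eq_kummerSelmerStructure`, unconditional); above `3` the place is `v₃`;
at the infinite place `H¹(ℝ, E[9]) = 0` (`9` odd).  Depth-`1` twin of n1011-p13's
`mem_selmerGroup_kummer_of_mem_propagated_of_localization_mem`. [cite: MilneADT2006, Ch. I, Lemma 3.3]
[cite: Rubin2011, §3.1 (p. 29)] -/
theorem mem_selmerGroup_kummer_nine_of_mem_propagated_of_localization_mem
    {x : galoisCohomology (W.torsionGaloisModule (((3 : ℕ) : ℤ) ^ 1 * ((3 : ℕ) : ℤ))) 1}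
    (hx : x ∈ (propagatedSelmerStructure W 3 1).selmerGroup)
    (v₃ : HeightOneSpectrum (𝓞 ℚ)) (hv₃ : ((3 : ℕ) : 𝓞 ℚ) ∈ v₃.asIdeal)
    (hx₃ : galoisCohomology.localization _ (Sum.inr v₃) 1 x ∈
      W.kummerSelmerStructure (((3 : ℕ) : ℤ) ^ 1 * ((3 : ℕ) : ℤ)) (Sum.inr v₃)) :
    x ∈ (W.kummerSelmerStructure (((3 : ℕ) : ℤ) ^ 1 * ((3 : ℕ) : ℤ))).selmerGroup := by
  haveI : Fact (Nat.Prime 3) := ⟨Nat.prime_three⟩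
  rw [SelmerStructure.mem_selmerGroup_iff] at hx ⊢
  rintro (w | v)
  · have h0 : galoisCohomology.localization _ (Sum.inl w) 1 x = 0 := by
      refine eq_zero_of_odd_nsmul_galoisCohomology_one_toLocal_inl _ w (n := 3 ^ (1 + 1))
        (by decide) _ ?_
      rw [← map_nsmul, galoisCohomology.nsmul_eq_zero_of_forall _
        (pow_succ_nsmul_geomTorsion_eq_zero W 3 1) x, map_zero]
    rw [h0]
    exact zero_mem _
  · by_cases hv : ((3 : ℕ) : 𝓞 ℚ) ∈ v.asIdeal
    · rw [heightOneSpectrum_eq_of_three_mem hv hv₃]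
      exact hx₃
    · rw [← propagatedSelmerStructure_inr_eq_kummerSelmerStructure W 3 1 hv]
      exact hx (Sum.inr v)

/-- **The bottom class of the depth-`1` dictionary is a `9`-Selmer class when its value vanishes.**
A family `κ₀` of classes of `E[9]`, a Kolyvagin system `κ′ ∈ KS(E[9], 𝓕_can, D)` congruent to it
(I4), a functional `Λ : H¹(ℚ_{v₃}, E[9]) → ℤ/9` with the KERNEL CLAUSE (`Λ = 0 ↔ Kummer` on
`𝓕_can(v₃)`), and `Λ(loc_{v₃} κ₀ ∅) = 0`: then `κ′_∅ = κ₀ ∅ ∈ Sel^(9)(E/ℚ)`.  Depth-`1` twin of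
n1011-p13's `apply_empty_mem_selmerGroup_kummer_of_apply_eq_zero`.
[cite: Kim2022StructureSelmer, Thm. 3.13 and §3.4.1] [cite: MazurRubin2004, App. A (33)] -/
theorem apply_empty_mem_selmerGroup_kummer_nine_of_apply_eq_zero
    {D : KolyvaginDatum (W.torsionGaloisModule (((3 : ℕ) : ℤ) ^ 1 * ((3 : ℕ) : ℤ)))}
    (v₃ : HeightOneSpectrum (𝓞 ℚ)) (hv₃ : ((3 : ℕ) : 𝓞 ℚ) ∈ v₃.asIdeal)
    (κ₀ : Finset (HeightOneSpectrum (𝓞 ℚ)) →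
      galoisCohomology (W.torsionGaloisModule (((3 : ℕ) : ℤ) ^ 1 * ((3 : ℕ) : ℤ))) 1)
    (κ' : D.kolyvaginSystems (propagatedSelmerStructure W 3 1))
    (hI4 : ∀ d, D.IsLevel d →
      κ'.1 d - κ₀ d ∈ AddSubgroup.closure {x | ∃ c, c ⊂ d ∧ x = κ₀ c})
    (Λ : galoisCohomology ((W.torsionGaloisModule (((3 : ℕ) : ℤ) ^ 1 * ((3 : ℕ) : ℤ))).toLocal
      (Sum.inr v₃)) 1 →+ ZMod (3 ^ (1 + 1)))
    (hΛker : ∀ x ∈ propagatedSelmerStructure W 3 1 (Sum.inr v₃),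
      Λ x = 0 ↔ x ∈ W.kummerSelmerStructure (((3 : ℕ) : ℤ) ^ 1 * ((3 : ℕ) : ℤ)) (Sum.inr v₃))
    (h0 : Λ (galoisCohomology.localization _ (Sum.inr v₃) 1 (κ₀ ∅)) = 0) :
    κ'.1 ∅ ∈ (W.kummerSelmerStructure (((3 : ℕ) : ℤ) ^ 1 * ((3 : ℕ) : ℤ))).selmerGroup := by
  have heq : κ'.1 ∅ = κ₀ ∅ := kolyvaginSystem_apply_empty_eq_of_congruence κ₀ κ' hI4
  have hmem : κ'.1 ∅ ∈ (propagatedSelmerStructure W 3 1).selmerGroup :=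
    ((KolyvaginDatum.mem_kolyvaginSystems_iff D _ κ'.1).mp κ'.2).apply_empty_mem
  have hmemF : galoisCohomology.localization _ (Sum.inr v₃) 1 (κ₀ ∅) ∈
      propagatedSelmerStructure W 3 1 (Sum.inr v₃) := by
    rw [← heq]
    exact (SelmerStructure.mem_selmerGroup_iff _ _).1 hmem (Sum.inr v₃)
  have hK : galoisCohomology.localization _ (Sum.inr v₃) 1 (κ'.1 ∅) ∈
      W.kummerSelmerStructure (((3 : ℕ) : ℤ) ^ 1 * ((3 : ℕ) : ℤ)) (Sum.inr v₃) := by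
    rw [heq]
    exact (hΛker _ hmemF).1 h0
  exact mem_selmerGroup_kummer_nine_of_mem_propagated_of_localization_mem W hmem v₃ hv₃ hK

/-- **`[3]_*` maps local `9`-Kummer classes to local `3`-Kummer classes**: `[3]_* κ_9(Q) = κ_3(3Q)`
(tree `map_torsionMulBy_localKummerClass`, Milne's "`b_{v,1} ↦ b_v`"). [cite: MilneADT2006, Ch. I §6, proof of Prop. 6.9] -/
theorem localMap_torsionMulBy_mem_kummerSelmerStructure (v : Place ℚ)
    {c : galoisCohomology ((W.torsionGaloisModule (((3 : ℕ) : ℤ) ^ 1 * ((3 : ℕ) : ℤ))).toLocal v) 1}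
    (hc : c ∈ W.kummerSelmerStructure (((3 : ℕ) : ℤ) ^ 1 * ((3 : ℕ) : ℤ)) v) :
    localMap (W.torsionMulBy (((3 : ℕ) : ℤ) ^ 1) ((3 : ℕ) : ℤ)) v c ∈
      W.kummerSelmerStructure ((3 : ℕ) : ℤ) v := by
  have h9 : (((3 : ℕ) : ℤ) ^ 1 * ((3 : ℕ) : ℤ)) ≠ 0 := by norm_num
  have h3 : ((3 : ℕ) : ℤ) ≠ 0 := by norm_num
  rw [kummerSelmerStructure_apply] at hc ⊢
  obtain ⟨Q, hQ, rfl⟩ :=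
    (W.mem_kummerLocalConditionAt_iff_exists_eq_localKummerClass _ h9 c).mp hc
  have hQ' : ((3 : ℕ) : ℤ) • ((((3 : ℕ) : ℤ) ^ 1) • Q) ∈
      MulAction.fixedPoints (absoluteGaloisGroup (Place.Completion v)) (localPoints W (Place.Completion v)) := by
    rw [smul_smul, mul_comm]
    exact hQ
  change galoisCohomology.map ((W.torsionMulBy (((3 : ℕ) : ℤ) ^ 1) ((3 : ℕ) : ℤ)).restrictField
    (Place.Completion v)) 1 _ ∈ _
  rw [W.map_torsionMulBy_localKummerClass _ _ h9 h3 Q hQ hQ']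
  exact (W.mem_kummerLocalConditionAt_iff_exists_eq_localKummerClass _ h3 _).mpr ⟨_, hQ', rfl⟩

/-- **`Sel^(3)(E/ℚ) = 0 ⟹ Sel^(9)(E/ℚ) = 0`**: a `9`-Selmer class `y` has `[3]_* y ∈ Sel^(3) = 0`,
so `y = incl_* z` (exactness of `H¹`), and `z ∈ Sel^(3)` because the Kummer conditions are
CARTESIAN (`incl_*⁻¹ 𝒦₉ = 𝒦₃`, n1011-p15 GEN 1 `map_torsionInclusion_mem_kummerLocalConditionAt_iff`),
so `z = 0`. [cite: MilneADT2006, Ch. I §6, proof of Prop. 6.9] [cite: Sakamoto2024, Def. 3.5 (p. 923)] -/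
theorem selmerGroup_kummer_nine_eq_zero_of_three
    (hSel3 : ∀ x ∈ (W.kummerSelmerStructure ((3 : ℕ) : ℤ)).selmerGroup, x = 0)
    {y : galoisCohomology (W.torsionGaloisModule (((3 : ℕ) : ℤ) ^ 1 * ((3 : ℕ) : ℤ))) 1}
    (hy : y ∈ (W.kummerSelmerStructure (((3 : ℕ) : ℤ) ^ 1 * ((3 : ℕ) : ℤ))).selmerGroup) : y = 0 := by
  have hy' := (SelmerStructure.mem_selmerGroup_iff _ _).mp hy
  -- `[3]_* y ∈ Sel^(3) = 0`
  have hred : galoisCohomology.map (W.torsionMulBy (((3 : ℕ) : ℤ) ^ 1) ((3 : ℕ) : ℤ)) 1 y ∈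
      (W.kummerSelmerStructure ((3 : ℕ) : ℤ)).selmerGroup := by
    rw [SelmerStructure.mem_selmerGroup_iff]
    intro v
    rw [localization_map_one]
    exact localMap_torsionMulBy_mem_kummerSelmerStructure W v (hy' v)
  obtain ⟨z, hz⟩ := exists_map_torsionInclusion_eq_of_map_torsionMulBy_eq_zero W y (hSel3 _ hred)
  -- `z ∈ Sel^(3)` (Kummer cartesian), hence `z = 0`
  have hz3 : z ∈ (W.kummerSelmerStructure ((3 : ℕ) : ℤ)).selmerGroup := by
    rw [SelmerStructure.mem_selmerGroup_iff]
    intro v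
    have h := hy' v
    rw [← hz, localization_map_one, kummerSelmerStructure_apply] at h
    rw [kummerSelmerStructure_apply]
    exact (Additive.map_torsionInclusion_mem_kummerLocalConditionAt_iff W (Place.Completion v)
      (Dvd.intro_left _ rfl) _).mp h
  rw [← hz, hSel3 z hz3, map_zero]

/-- **`incl_*` maps `𝓕̄_can(E[3])_v` into `𝓕_can(E[9])_v`**: `𝓕̄_can = [3]_* 𝓕_can` (n1011-p13's
`induced_propagatedSelmerStructure`) and `incl ∘ [3] = 3` on `E[9]`, so `incl_* [3]_* z = 3 • z`.
[cite: Sakamoto2024, §2 (p. 921) and §3.1.1] -/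
theorem localMap_torsionInclusion_mem_propagatedSelmerStructure (v : Place ℚ)
    {y : galoisCohomology ((W.torsionGaloisModule ((3 : ℕ) : ℤ)).toLocal v) 1}
    (hy : y ∈ propagatedSelmerStructureOne W 3 v) :
    localMap (W.torsionInclusion (Dvd.intro_left _ rfl : ((3 : ℕ) : ℤ) ∣ ((3 : ℕ) : ℤ) ^ 1 * ((3 : ℕ) : ℤ)))
      v y ∈ propagatedSelmerStructure W 3 1 v := by
  haveI : Fact (Nat.Prime 3) := ⟨Nat.prime_three⟩
  rw [← induced_propagatedSelmerStructure W 3 1] at hy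
  obtain ⟨z, hz, rfl⟩ := (SelmerStructure.mem_induced_iff _ _ v y).mp hy
  obtain ⟨ζ, rfl⟩ := oneCocycleClass_surjective _ z
  have h3 : localMap (W.torsionInclusion (Dvd.intro_left _ rfl :
        ((3 : ℕ) : ℤ) ∣ ((3 : ℕ) : ℤ) ^ 1 * ((3 : ℕ) : ℤ))) v
      (localMap (W.torsionMulBy (((3 : ℕ) : ℤ) ^ 1) ((3 : ℕ) : ℤ)) v (oneCocycleClass _ ζ)) =
      oneCocycleClass _ ζ + oneCocycleClass _ ζ + oneCocycleClass _ ζ := by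
    rw [localMap_torsionMulBy_oneCocycleClass, localMap_torsionInclusion_oneCocycleClass,
      ← oneCocycleClass_add, ← oneCocycleClass_add]
    congr 1
    apply Subtype.ext
    ext g
    rw [coe_inclCocycle_apply, coe_redCocycle_apply]
    change _ = (((ζ.1 g + ζ.1 g + ζ.1 g : geomTorsion W _)) : geomPoints W)
    rw [AddSubgroup.coe_add, AddSubgroup.coe_add]
    have key : ∀ Pt : geomPoints W, (((3 : ℕ) : ℤ) ^ 1) • Pt = Pt + Pt + Pt := fun Pt => by
      rw [pow_one, show ((3 : ℕ) : ℤ) = 1 + 1 + 1 from by norm_num, add_zsmul, add_zsmul, one_zsmul]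
    exact key _
  rw [h3]
  exact add_mem (add_mem hz hz) hz

/-- The `3`-torsion of `ℤ/9` has three elements. [folklore] -/
theorem card_torsion_three_zmod_nine :
    Nat.card {a : ZMod (3 ^ (1 + 1)) // (3 : ℕ) • a = 0} ≤ 3 := by
  rw [Nat.card_eq_fintype_card]
  decide

end KSDevissage

/-! ### §2 END-m2 -/
/-- **END-m2 — "nine divides Ш" on class A2, the level-TWO non-unit lower end (ROUTE-1 §33.3's A2
analogue of R1-57, DATUM-GENERIC per route planner 1 GEN 23).**  Let `W/ℚ` be globally minimal with
ADDITIVE reduction at `3`, `3 ∤ c₃`, `ρ̄_{E,3}` onto (so `E(ℚ)[3] = 0`, `h0`), **`#E(ℚ₃)[3] = 3`**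
(`t = 1`), and let `D₉` be a Kolyvagin datum on `E[9]` with primes in Sakamoto's level-`9` class of
`τ` (`τ ∈ Gal(ℚ̄/ℚ(μ₉))`, `E[9]/(τ − 1) ≅ ℤ/9`, `E[3]/(τ − 1) ≅ ℤ/3`; e.g. THE deep class through
`E[27]` of the port guard), outside an admissible `S`, cyclotomic transverse conditions, THE
canonical comparison maps, admissible; `D₃` the datum on `E[3]` with the same primes / transverse
conditions / canonical maps.  ASSUME the depth-`1` dictionary `KatoKuriharaDictionaryThreeAt W 1 1 D₉ v₃`
(the PORT — flag K22-Thm3.13-PORT@3, NOT in print at `3`), a modular parametrisation with `3 ∤ c_P`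
and the unit period transfer, `3 · [0]⁺ ≡ 0 (mod 9)` (`3 ∣ L(E,1)/Ω⁺_f`), ONE level `n` of `D₉` with
surjective discrete logarithms `ψ₀` and **`3 · δ̃_n ≠ 0` in `ℤ/9`** (`δ̃_n` a `3`-adic unit; no `ν(n)`,
no sub-level vanishing, no parity), and INJECTIVITY at the core vertex `∅` on `KS(E[3], 𝓕̄_can, D₃)`
(`hinj`, n1011-p11's G5 / R1-58 `apply_eq_zero_of_apply_empty_eq_zero` with p15's deep pair choice).
THEN `Sel^(3)(E/ℚ)` has a non-zero element (hence, n1011-p18's R1-57-B bridges: `9 ∣ #Ш(E)[3^∞]`).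
[cite: Kim2022StructureSelmer, Thm. 3.13] [cite: MazurRubin2004, Thm. 3.2.4 and §4.5]
[cite: Sakamoto2024, Def. 3.5 (p. 923) and Thm. 4.4 (1) (p. 926)] -/
theorem exists_ne_zero_mem_selmerGroup_three_of_dictionaryTwo_of_levelTwo_certificate
    [W.IsGloballyMinimal] [Finite (geomTorsion W ((3 : ℕ) : ℤ))]
    (h3 : W.HasSurjectiveModNGaloisRep ((3 : ℕ) : ℤ))
    (h0 : ∀ P : geomTorsion W ((3 : ℕ) : ℤ),
      (∀ σ : absoluteGaloisGroup ℚ, W.torsionGaloisModule ((3 : ℕ) : ℤ) σ P = P) → P = 0)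
    (inv : LocalInvariants ℚ 3) (hperf : inv.IsPerfect) (hsum : inv.SumLocalTermEqZero)
    (hcompl : inv.SelmerComplement)
    (hEP : ∀ v : HeightOneSpectrum (𝓞 ℚ), localEulerPoincareCharacteristic (v.adicCompletion ℚ))
    (S : Finset (Place ℚ))
    (h3S : ∀ v : HeightOneSpectrum (𝓞 ℚ), ((3 : ℕ) : 𝓞 ℚ) ∈ v.asIdeal → (Sum.inr v : Place ℚ) ∈ S)
    (hbadS : ∀ v : HeightOneSpectrum (𝓞 ℚ), ¬ W.HasGoodReductionAt v → (Sum.inr v : Place ℚ) ∈ S)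
    (h𝓕₉ : (propagatedSelmerStructure W 3 1).IsUnramifiedOutside S)
    (h𝓕₃ : (propagatedSelmerStructureOne W 3).IsUnramifiedOutside S)
    {Sset : Set (HeightOneSpectrum (𝓞 ℚ))} {τ : absoluteGaloisGroup ℚ}
    (hτμ : τ ∈ rootsOfUnityFixer ℚ (3 ^ (1 + 1)))
    (hτ₉ : Nonempty (cokerSubOne (W.torsionGaloisModule (((3 : ℕ) : ℤ) ^ 1 * ((3 : ℕ) : ℤ))) τ ≃+
      ZMod (3 ^ (1 + 1))))
    (hτ₃ : Nonempty (cokerSubOne (W.torsionGaloisModule ((3 : ℕ) : ℤ)) τ ≃+ ZMod 3))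
    (D₉ : KolyvaginDatum (W.torsionGaloisModule (((3 : ℕ) : ℤ) ^ 1 * ((3 : ℕ) : ℤ))))
    (D₃ : KolyvaginDatum (W.torsionGaloisModule ((3 : ℕ) : ℤ))) (hP : D₃.primes = D₉.primes)
    (hP₉ : D₉.primes ⊆ frobeniusClassPrimes
      (W.torsionGaloisModule (((3 : ℕ) : ℤ) ^ 1 * ((3 : ℕ) : ℤ))) Sset τ (3 ^ (1 + 1)))
    (hPS : ∀ q ∈ D₉.primes, (Sum.inr q : Place ℚ) ∉ S)
    (hT₉ : D₉.transverse = cyclotomicTransverse _) (hT₃ : D₃.transverse = cyclotomicTransverse _)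
    {η : (q : HeightOneSpectrum (𝓞 ℚ)) → (ZMod (Ideal.absNorm q.asIdeal))ˣ}
    (hD₉ : D₉.HasCanonicalComparison (3 ^ (1 + 1)) η) (hD₃ : D₃.HasCanonicalComparison 3 η)
    (hadm₉ : D₉.IsAdmissible)
    (v₃ : HeightOneSpectrum (𝓞 ℚ)) (hv₃ : ((3 : ℕ) : 𝓞 ℚ) ∈ v₃.asIdeal)
    (hDict : KatoKuriharaDictionaryThreeAt W 1 1 D₉ v₃)
    (hX : Addv W 3) (hc3 : ¬ 3 ∣ (W.baseChange ℚ_[3]).localTamagawaNumber ℤ_[3])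
    (ht : Nat.card {Q : (W.baseChange ℚ_[3]).toAffine.Point // (3 : ℕ) • Q = 0} = 3 ^ 1)
    {N : ℕ} [NeZero N] (P : ModularParametrizationData W N)
    (hManin : ¬ ((3 : ℕ) : ℤ) ∣ P.maninConstant)
    (hΩ : ∃ u : ℚ, ‖(u : ℚ_[3])‖ = 1 ∧ W.realPeriodRat = u * plusPeriod P.f)
    (hzero : (3 : ZMod (3 ^ (1 + 1))) * ratModP (3 ^ (1 + 1)) (ratPlusSymbol P.f 0) = 0)
    -- the certificate: ONE level `n` of `D₉` with `δ̃_n ≢ 0 (mod 3)`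
    (n : Finset (HeightOneSpectrum (𝓞 ℚ))) (hn : D₉.IsLevel n)
    {ψ₀ : (ℓ : ℕ) → (ZMod ℓ)ˣ →* Multiplicative (ZMod (3 ^ (1 + 1)))}
    (hψ₀ : ∀ q ∈ n, Function.Surjective (ψ₀ (Ideal.absNorm q.asIdeal)))
    (hcert : haveI : NeZero (∏ q ∈ n, Ideal.absNorm q.asIdeal) :=
        ⟨Finset.prod_ne_zero_iff.2 fun q _ => Assembly.absNorm_ne_zero q⟩
      (3 : ZMod (3 ^ (1 + 1))) * kuriharaNumber P.f (3 ^ (1 + 1)) (∏ q ∈ n, Ideal.absNorm q.asIdeal) ψ₀ ≠ 0)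
    -- injectivity at the core vertex `∅` on the `E[3]`-datum (n1011-p11's G5 / R1-58)
    (hinj : ∀ κ : Finset (HeightOneSpectrum (𝓞 ℚ)) →
        galoisCohomology (W.torsionGaloisModule ((3 : ℕ) : ℤ)) 1,
      D₃.IsKolyvaginSystem (propagatedSelmerStructureOne W 3) κ →
      (inv.dualSelmerStructure (W.torsionGaloisModule ((3 : ℕ) : ℤ))
        (D₃.atLevel (propagatedSelmerStructureOne W 3) ∅)).selmerGroup = ⊥ →
      κ ∅ = 0 → ∀ m, κ m = 0) :
    ∃ x ∈ (W.kummerSelmerStructure ((3 : ℕ) : ℤ)).selmerGroup, x ≠ 0 := by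
  haveI : Fact (Nat.Prime 3) := ⟨Nat.prime_three⟩
  -- (1) the dictionary at depth 1: Kato-type classes `κ₀` of `E[9]`, `Λ`, the Kolyvagin system `κ'`
  obtain ⟨κ₀, Λ, -, ⟨κ', hI4⟩, -, hΛker, hdict⟩ := hDict hX hc3 h3 ht hv₃ P hManin hΩ
  have hκ'KS : D₉.IsKolyvaginSystem (propagatedSelmerStructure W 3 1) κ'.1 :=
    (KolyvaginDatum.mem_kolyvaginSystems_iff D₉ _ κ'.1).mp κ'.2
  -- at `∅`: `Λ(loc κ₀ ∅) = u · 3 · [0]⁺ = 0` in `ℤ/9`, so `κ'_∅ ∈ Sel^(9)`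
  have hSel9 : κ'.1 ∅ ∈ (W.kummerSelmerStructure (((3 : ℕ) : ℤ) ^ 1 * ((3 : ℕ) : ℤ))).selmerGroup := by
    obtain ⟨u, ψ, -, hval⟩ := hdict ∅ D₉.isLevel_empty
    rw [kuriharaNumber_eq_ratModP_of_eq_one P.f (3 ^ (1 + 1)) _ _ Finset.prod_empty ψ] at hval
    have hz : Λ (galoisCohomology.localization _ (Sum.inr v₃) 1 (κ₀ ∅)) = 0 := by
      rw [hval, pow_one, mul_assoc, hzero, mul_zero]
    exact KSDevissage.apply_empty_mem_selmerGroup_kummer_nine_of_apply_eq_zero W v₃ hv₃ κ₀ κ' hI4 Λ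
      hΛker hz
  -- at `n`: `Λ(loc κ₀ n) = u · 3 · δ̃_n(ψ) ≠ 0` (ψ-independence), so `κ₀ n ≠ 0`
  have hκ₀n : κ₀ n ≠ 0 := by
    obtain ⟨u, ψ, hψ, hval⟩ := hdict n hn
    haveI : NeZero (∏ q ∈ n, Ideal.absNorm q.asIdeal) :=
      ⟨Finset.prod_ne_zero_iff.2 fun q _ => Assembly.absNorm_ne_zero q⟩
    have hNp : ∀ q ∈ n, (Ideal.absNorm q.asIdeal).Prime := fun q _ => FSComp.prime_absNorm_rat q
    have hNinj := Assembly.absNorm_injOn (↑n : Set (HeightOneSpectrum (𝓞 ℚ)))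
    have h1 := Shallow.forall_primeFactors_of_forall_mem _ n hNp hNinj hψ
    have h2 := Shallow.forall_primeFactors_of_forall_mem _ n hNp hNinj hψ₀
    obtain ⟨u', hu'⟩ := exists_units_kuriharaNumber_eq_mul P.f (3 ^ (1 + 1))
      (∏ q ∈ n, Ideal.absNorm q.asIdeal) h2 h1
    intro hκ0
    have hv0 : Λ (galoisCohomology.localization _ (Sum.inr v₃) 1 (κ₀ n)) = 0 := by
      rw [hκ0, map_zero, map_zero]
    rw [hval, pow_one, hu'] at hv0
    apply hcert
    have h' : ((u : ZMod (3 ^ (1 + 1))) * u') *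
        ((3 : ZMod (3 ^ (1 + 1))) * kuriharaNumber P.f (3 ^ (1 + 1))
          (∏ q ∈ n, Ideal.absNorm q.asIdeal) ψ₀) = 0 := by
      rw [← hv0]; ring
    exact ((u.isUnit.mul u'.isUnit).mul_right_eq_zero).mp h'
  -- p09 §A: `κ'` is non-zero at some level `c ⊆ n`
  obtain ⟨c, -, -, hκ'c⟩ := exists_subset_apply_ne_zero_of_congruence κ₀ κ'.1 hI4 hn hκ₀n
  by_cases hcore : (inv.dualSelmerStructure (W.torsionGaloisModule ((3 : ℕ) : ℤ))
      (D₃.atLevel (propagatedSelmerStructureOne W 3) ∅)).selmerGroup = ⊥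
  · -- (3) `∅` a core vertex: if `Sel^(3) = 0` then `Sel^(9) = 0`, `κ'_∅ = 0`, and the DÉVISSAGE kills `κ'`
    by_contra hnone
    push Not at hnone
    have h9 : κ'.1 ∅ = 0 := KSDevissage.selmerGroup_kummer_nine_eq_zero_of_three W hnone hSel9
    exact hκ'c (KSDevissage.apply_eq_zero_of_apply_eq_zero_levelTwo W h0 h𝓕₉ h𝓕₃ hτμ hτ₉ hτ₃ hP hP₉
      hPS hT₉ hT₃ hD₉ hD₃ hadm₉ (fun lam hlam hlam0 => hinj lam hlam hcore hlam0) hκ'KS h9 c)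
  -- (4) `∅` not a core vertex: `#H¹_{𝓕̄_can} = 3 · #H¹_{𝓕̄_can^*} ≥ 6`, and the functional
  -- `Λ ∘ loc_{v₃} ∘ incl_*` has `3`-torsion values and kernel inside `Sel^(3)`
  let T : Finset (HeightOneSpectrum (𝓞 ℚ)) := S.preimage Sum.inr Sum.inr_injective.injOn
  have h3T : ∀ v : HeightOneSpectrum (𝓞 ℚ), ((3 : ℕ) : 𝓞 ℚ) ∈ v.asIdeal → v ∈ T :=
    fun v hv => Finset.mem_preimage.mpr (h3S v hv)
  have hbadT : ∀ v : HeightOneSpectrum (𝓞 ℚ), ¬ W.HasGoodReductionAt v → v ∈ T :=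
    fun v hv => Finset.mem_preimage.mpr (hbadS v hv)
  have hχ := hasCoreRank_one_propagatedSelmerStructureOne_of_isPerfect_of_localEuler W inv hperf hsum
    hcompl hEP T h3T hbadT
  haveI hfin := finite_selmerGroup_propagatedSelmerStructureOne_three W
  haveI hfind := finite_dualSelmerGroup_propagatedSelmerStructureOne_three W inv hperf hsum hcompl hEP T
    h3T hbadT
  have hmod : D₃.atLevel (propagatedSelmerStructureOne W 3) ∅ = propagatedSelmerStructureOne W 3 :=
    SelmerStructure.modify_empty _ D₃.transverse
  rw [hmod] at hcore
  rw [LocalInvariants.HasCoreRank, pow_one] at hχ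
  have h2 : 2 ≤ Nat.card (inv.dualSelmerStructure (W.torsionGaloisModule ((3 : ℕ) : ℤ))
      (propagatedSelmerStructureOne W 3)).selmerGroup := by
    by_contra hlt
    push Not at hlt
    have h1 : Nat.card (inv.dualSelmerStructure (W.torsionGaloisModule ((3 : ℕ) : ℤ))
        (propagatedSelmerStructureOne W 3)).selmerGroup = 1 := by
      have hpos : 0 < Nat.card (inv.dualSelmerStructure (W.torsionGaloisModule ((3 : ℕ) : ℤ))
          (propagatedSelmerStructureOne W 3)).selmerGroup := Nat.card_pos
      omega
    exact hcore (AddSubgroup.card_eq_one.1 h1)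
  set H := (propagatedSelmerStructureOne W 3).selmerGroup with hH
  let ι := galoisCohomology.map
    (W.torsionInclusion (Dvd.intro_left _ rfl : ((3 : ℕ) : ℤ) ∣ ((3 : ℕ) : ℤ) ^ 1 * ((3 : ℕ) : ℤ))) 1
  let φ : H →+ ZMod (3 ^ (1 + 1)) :=
    (Λ.comp ((galoisCohomology.localization
      (W.torsionGaloisModule (((3 : ℕ) : ℤ) ^ 1 * ((3 : ℕ) : ℤ))) (Sum.inr v₃) 1).comp ι)).comp H.subtype
  have hφ : ∀ x : H, φ x = Λ (galoisCohomology.localization _ (Sum.inr v₃) 1 (ι x)) := fun x => rfl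
  -- its kernel lies in `Sel^(3)` (Λ-kernel clause + Kummer cartesian)
  have hker : ∀ x : H, φ x = 0 → (x : galoisCohomology _ 1) ∈
      (W.kummerSelmerStructure ((3 : ℕ) : ℤ)).selmerGroup := by
    intro x hx
    have hxF : galoisCohomology.localization _ (Sum.inr v₃) 1 (x : galoisCohomology _ 1) ∈
        propagatedSelmerStructureOne W 3 (Sum.inr v₃) :=
      (SelmerStructure.mem_selmerGroup_iff _ _).1 x.2 (Sum.inr v₃)
    have hιF : galoisCohomology.localization _ (Sum.inr v₃) 1 (ι x) ∈
        propagatedSelmerStructure W 3 1 (Sum.inr v₃) := by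
      rw [KSDevissage.localization_map_one]
      exact KSDevissage.localMap_torsionInclusion_mem_propagatedSelmerStructure W _ hxF
    have hK9 := (hΛker _ hιF).1 (by rw [← hφ]; exact hx)
    rw [KSDevissage.localization_map_one, kummerSelmerStructure_apply] at hK9
    have hK3 := (Additive.map_torsionInclusion_mem_kummerLocalConditionAt_iff W
      (Place.Completion (Sum.inr v₃ : Place ℚ)) (Dvd.intro_left _ rfl) _).mp hK9
    exact mem_selmerGroup_kummer_of_mem_propagated_of_localization_mem W hEP x.2 v₃ hv₃ hK3
  -- its values are `3`-torsion
  have h3φ : ∀ x : H, (3 : ℕ) • φ x = 0 := fun x => by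
    rw [← map_nsmul]
    have hx3 : (3 : ℕ) • x.1 = 0 :=
      galoisCohomology.nsmul_eq_zero_of_forall _ (three_nsmul_geomTorsion_three W) x.1
    have : (3 : ℕ) • x = 0 := Subtype.ext hx3
    rw [this, map_zero]
  -- a non-zero element of the kernel: otherwise `H` injects into the `3`-torsion of `ℤ/9`
  by_contra hnone
  push Not at hnone
  have hinjφ : Function.Injective fun x : H => (⟨φ x, h3φ x⟩ : {a : ZMod (3 ^ (1 + 1)) // (3 : ℕ) • a = 0}) := by
    intro x y hxy
    have hxy' : φ x = φ y := congrArg Subtype.val hxy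
    have hk : φ (x - y) = 0 := by rw [map_sub, hxy', sub_self]
    have hmem := hker (x - y) hk
    have h0' : (x - y).1 = 0 := hnone _ hmem
    exact sub_eq_zero.mp (Subtype.ext h0')
  have hle : Nat.card H ≤ 3 :=
    (Nat.card_le_card_of_injective _ hinjφ).trans KSDevissage.card_torsion_three_zmod_nine
  omega

end Summit.BirchSwinnertonDyer.Rank1Residual.GaloisImage

end
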